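import Literature.Barriers.CriticalPhenomena.WeaklySAWFlowContinuity
import Literature.Barriers.CriticalPhenomena.WeaklySAWFlowTheoremCutoff
import HarnessLib

/-!
# [BBS-rg-flow, Corollary 1.8] at a FIXED general cut-off `k`: continuity of the critical flow in
# `(m, K₀, g₀)` when the weights `χ_j = Ω^{-(j-k)₊}` do not depend on the external parameter

`WeaklySAWFlowContinuity.lean` proves [BBS-rg-flow, Corollary 1.8] (= BBS 2015, Corollary 7.2.2) for
the flow of Theorem 1.4 built from (A1)–(A2), i.e. with the weights `χ_j(m) = Ω^{-(j-j_Ω(m))₊}` of the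
parameter `m` itself — which forces the explicit extra hypothesis "`χ_j(m') → χ_j(m)`" (false at the
jumps of the integer `j_Ω(m)`). BBS 2015, §7.3 instead applies the flow theorem on a patch around
`(m̃², g̃₀)` with the weights FROZEN, "`χ̃_j = χ_j(m̃²)`" (display (Djdef-2)), so that on the patch the
weights are constant in the external parameter. This file is that version of Corollary 1.8: the same
statement and proof as `critFlow_continuousWithinAt`, for the flow `critFlowK` of
`BBS_thm14_exists_flow_cutoff` (hypothesis: `CutoffQuadHyp (Pf m) Ω k …` at every admissible
`(m, g₀)`, one FIXED `k`), the continuity hypothesis on `χ` having become vacuous. The continuity of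
`V̄_j(m, g₀)` still comes from (A1)–(A2) at each `m` (`continuousOn_flow_param`), kept as the separate
hypothesis `hA12`. For the 4d weakly SAW both hypotheses are available
(`cutoffQuadHyp_wsaw_frozen`, `BBS2015_hypA12_package`).

* `AdmK`, `critFlowK`, `critFlowK_spec`, `BoundAtK`, `flowBounds_iff_boundAtK`, `norm_Kb_le_cutoff`,
  `mem_flowDomain_of_boundAtK`, `boundAtK_base`, `norm_critFlowK_zero_le(')`, `tendsto_flow_of_le_nhdsK`,
  `boundAtK_of_tendsto`, `critFlowK_tendsto_of_tendsto_zero`;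
* **`critFlowK_continuousWithinAt`** — Corollary 1.8 with frozen weights: `x_j(m, K₀, g₀)` is continuous
  at every admissible point within the admissible set, WITHOUT any hypothesis on `m ↦ χ_j`.
-/

noncomputable section

open Filter Topology Set
open scoped BigOperators

namespace Literature.Barriers.CriticalPhenomena

namespace CTWSAW

section Corollary18

variable {Mext : Type*}
variable {W : ℕ → Type*} [∀ j, NormedAddCommGroup (W j)] [∀ j, NormedSpace ℝ (W j)] [∀ j, CompleteSpace (W j)]

variable (Pf : Mext → QuadFlowParams) (ψf : ∀ m : Mext, ∀ j, W j × V3 → W (j + 1)) (ρf : ∀ m : Mext, ∀ j, W j × V3 → V3)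
  (Ω B c lam C a κ R M aStar b hh : ℝ)

/-- The admissible parameter points `q = (m, K₀, g₀)`: `0 < g₀ ≤ g_*`, `‖K₀‖ ≤ a_*g₀³` and (A3) at
`(m, g₀)` (the set `𝓘` of Theorem 1.4 over all `m`). [cite: BauerschmidtBrydgesSlade2015Flow, Theorem 1.4 and Corollary 1.8] -/
def AdmK (k : ℕ∞) (q : Mext × (W 0 × ℝ)) : Prop :=
  0 < q.2.2 ∧ q.2.2 ≤ gThreshold Ω B c C lam M a aStar κ R b hh ∧ ‖q.2.1‖ ≤ aStar * q.2.2 ^ 3 ∧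
    HypA3 (cutoffWeight Ω k) (ψf q.1) (ρf q.1) ((Pf q.1).flow q.2.2) a hh κ Ω R M

variable {Pf Ω B c lam C a κ R M aStar b hh}
variable {k : ℕ∞}

open Classical in
/-- **The critical flow** `x(m, u₀) = (K_j, V_j)_j(m, K₀, g₀)`: the unique global flow of
`Φ(m) = (ψ(m), φ̄(m) + ρ(m))` with `K₀`, `g₀` prescribed, `(z_∞, μ_∞) = (0,0)` and the bounds (1.11)–(1.14)
given by Theorem 1.4(i) (`BBS_thm14_exists_flow`) at admissible `q`; `0` elsewhere.
[cite: BauerschmidtBrydgesSlade2015Flow, Corollary 1.8 ("the global flow … guaranteed by Theorem 1.4")] -/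
def critFlowK (hc : ConstHyp Ω c lam C a κ R M aStar b hh)
    (hA : ∀ (m : Mext) (g : ℝ), 0 < g → g ≤ gThreshold Ω B c C lam M a aStar κ R b hh →
      CutoffQuadHyp (Pf m) Ω k B c ⌊c⁻¹⌋₊ C lam g) (q : Mext × (W 0 × ℝ)) : ∀ j, W j × V3 :=
  if hq : AdmK Pf ψf ρf Ω B c lam C a κ R M aStar b hh k q then
    Classical.choose (BBS_thm14_exists_flow_cutoff hc.one_lt_Ω hc.κ_pos hc.κΩ_lt hc.R_pos hc.M_pos hc.aStar_gt hc.aStar_lt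
      hc.b_pos hc.b_lt hh hc.hh_ge (Pf q.1) (ψf q.1) (ρf q.1) (hA q.1 q.2.2 hq.1 hq.2.1) hq.1 hq.2.1 hq.2.2.2 hq.2.2.1)
  else fun _ => 0

/-- The defining properties of the critical flow at an admissible point: it lies in `∏D_j`, is a flow of
`Φ(m)`, has `K₀`, `g₀` prescribed, `(z_j, μ_j) → 0`, obeys (1.11)–(1.14), and is unique with these properties.
[cite: BauerschmidtBrydgesSlade2015Flow, Theorem 1.4(i)] -/
theorem critFlowK_spec (hc : ConstHyp Ω c lam C a κ R M aStar b hh)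
    (hA : ∀ (m : Mext) (g : ℝ), 0 < g → g ≤ gThreshold Ω B c C lam M a aStar κ R b hh →
      CutoffQuadHyp (Pf m) Ω k B c ⌊c⁻¹⌋₊ C lam g) {q : Mext × (W 0 × ℝ)}
    (hq : AdmK Pf ψf ρf Ω B c lam C a κ R M aStar b hh k q) :
    (∀ j, critFlowK ψf ρf hc hA q j ∈ flowDomain (cutoffWeight Ω k) ((Pf q.1).flow q.2.2) a hh j) ∧
    IsPerturbedFlow (Pf q.1) (ψf q.1) (ρf q.1) (critFlowK ψf ρf hc hA q) ∧
    (critFlowK ψf ρf hc hA q 0).1 = q.2.1 ∧ (critFlowK ψf ρf hc hA q 0).2 0 = q.2.2 ∧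
    Tendsto (fun j => (critFlowK ψf ρf hc hA q j).2 1) atTop (𝓝 0) ∧ Tendsto (fun j => (critFlowK ψf ρf hc hA q j).2 2) atTop (𝓝 0) ∧
    FlowBounds (cutoffWeight Ω k) (ψf q.1) ((Pf q.1).flow q.2.2) q.2.1 a aStar hh b (critFlowK ψf ρf hc hA q) ∧
    ∀ x' : ∀ j, W j × V3, IsPerturbedFlow (Pf q.1) (ψf q.1) (ρf q.1) x' → (x' 0).1 = q.2.1 → (x' 0).2 0 = q.2.2 →
      Tendsto (fun j => (x' j).2 1) atTop (𝓝 0) → Tendsto (fun j => (x' j).2 2) atTop (𝓝 0) →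
      FlowBounds (cutoffWeight Ω k) (ψf q.1) ((Pf q.1).flow q.2.2) q.2.1 a aStar hh b x' → x' = critFlowK ψf ρf hc hA q := by
  have hdef : critFlowK ψf ρf hc hA q = Classical.choose (BBS_thm14_exists_flow_cutoff hc.one_lt_Ω hc.κ_pos hc.κΩ_lt hc.R_pos hc.M_pos
      hc.aStar_gt hc.aStar_lt hc.b_pos hc.b_lt hh hc.hh_ge (Pf q.1) (ψf q.1) (ρf q.1) (hA q.1 q.2.2 hq.1 hq.2.1)
      hq.1 hq.2.1 hq.2.2.2 hq.2.2.1) := by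
    simp only [critFlowK, dif_pos hq]
  rw [hdef]
  exact Classical.choose_spec (BBS_thm14_exists_flow_cutoff hc.one_lt_Ω hc.κ_pos hc.κΩ_lt hc.R_pos hc.M_pos
      hc.aStar_gt hc.aStar_lt hc.b_pos hc.b_lt hh hc.hh_ge (Pf q.1) (ψf q.1) (ρf q.1) (hA q.1 q.2.2 hq.1 hq.2.1)
      hq.1 hq.2.1 hq.2.2.2 hq.2.2.1)

variable [TopologicalSpace Mext]

end Corollary18

section Corollary18b

variable {Mext : Type*}
variable {W : ℕ → Type*} [∀ j, NormedAddCommGroup (W j)] [∀ j, NormedSpace ℝ (W j)] [∀ j, CompleteSpace (W j)]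
variable {Pf : Mext → QuadFlowParams} (ψf : ∀ m : Mext, ∀ j, W j × V3 → W (j + 1)) (ρf : ∀ m : Mext, ∀ j, W j × V3 → V3)
  {Ω B c lam C a κ R M aStar b hh : ℝ} {k : ℕ∞}

/-- The `j`-th clause of the bounds (1.11)–(1.14) at the parameter point `q`. [cite: BauerschmidtBrydgesSlade2015Flow, Theorem 1.4, (1.11)–(1.14)] -/
def BoundAtK (Pf : Mext → QuadFlowParams) (Ω : ℝ) (k : ℕ∞) (a aStar hh b : ℝ) (q : Mext × (W 0 × ℝ)) (j : ℕ) (xj : W j × V3) : Prop :=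
  ‖xj.1 - Kb ψf Pf q j‖ ≤ b * (a - aStar) * cutoffWeight Ω k j * (Pf q.1).flow q.2.2 j 0 ^ 3 ∧
    |xj.2 0 - (Pf q.1).flow q.2.2 j 0| ≤ b * hh * (Pf q.1).flow q.2.2 j 0 ^ 2 * |Real.log ((Pf q.1).flow q.2.2 j 0)| ∧
    |xj.2 1 - (Pf q.1).flow q.2.2 j 1| ≤ b * hh * cutoffWeight Ω k j * (Pf q.1).flow q.2.2 j 0 ^ 2 * |Real.log ((Pf q.1).flow q.2.2 j 0)| ∧
    |xj.2 2 - (Pf q.1).flow q.2.2 j 2| ≤ b * hh * cutoffWeight Ω k j * (Pf q.1).flow q.2.2 j 0 ^ 2 * |Real.log ((Pf q.1).flow q.2.2 j 0)|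

omit [∀ j, NormedSpace ℝ (W j)] [∀ j, CompleteSpace (W j)] in
/-- The bounds (1.11)–(1.14) clause by clause. [cite: BauerschmidtBrydgesSlade2015Flow, Theorem 1.4] -/
theorem flowBounds_iff_boundAtK (q : Mext × (W 0 × ℝ)) (x : ∀ j, W j × V3) :
    FlowBounds (cutoffWeight Ω k) (ψf q.1) ((Pf q.1).flow q.2.2) q.2.1 a aStar hh b x ↔
      ∀ j, BoundAtK ψf Pf Ω k a aStar hh b q j (x j) := Iff.rfl

omit [∀ j, CompleteSpace (W j)] in
/-- **Lemma 1.3 at an admissible point**: `‖K̄_j‖ ≤ a_*χ_jḡ_j³` (the threshold `g_*` was chosen so that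
`R + κa_*ϑ ≤ a_*`). [cite: BauerschmidtBrydgesSlade2015Flow, Lemma 1.3] -/
theorem norm_Kb_le_cutoff (hc : ConstHyp Ω c lam C a κ R M aStar b hh)
    (hA : ∀ (m : Mext) (g : ℝ), 0 < g → g ≤ gThreshold Ω B c C lam M a aStar κ R b hh →
      CutoffQuadHyp (Pf m) Ω k B c ⌊c⁻¹⌋₊ C lam g) {q : Mext × (W 0 × ℝ)}
    (hq : AdmK Pf ψf ρf Ω B c lam C a κ R M aStar b hh k q) (j : ℕ) :
    ‖Kb ψf Pf q j‖ ≤ aStar * cutoffWeight Ω k j * (Pf q.1).flow q.2.2 j 0 ^ 3 := by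
  obtain ⟨hg₀, hgs, hK₀, hA3⟩ := hq
  have hΩ := hc.one_lt_Ω; have hκ := hc.κ_pos; have hκΩ := hc.κΩ_lt; have hR := hc.R_pos
  have haStar := hc.aStar_gt
  have hΩ0 : 0 < Ω := by linarith
  have h1κ : 0 < 1 - κ * Ω := by linarith
  have ha0 : 0 < aStar := lt_trans (div_pos hR h1κ) haStar
  have hB : 0 ≤ B := (hA q.1 q.2.2 hg₀ hgs).B_nonneg
  have hgr : q.2.2 ≤ (1 - (ratioMargin Ω κ R aStar)⁻¹) / (6 * B + 1) := hgs.trans ((min_le_left _ _).trans (min_le_right _ _))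
  have h := hA q.1 q.2.2 hg₀ hgs
  have hq1 : 1 < ratioMargin Ω κ R aStar := one_lt_ratioMargin hΩ0 hκ hκΩ hR haStar
  have hcube : ((1 - 2 * B * q.2.2)⁻¹) ^ 3 ≤ ratioMargin Ω κ R aStar := by
    refine inv_cube_le_of_small hB hg₀.le hq1.le ?_
    have h6 : 0 < 6 * B + 1 := by positivity
    have h7 := (le_div_iff₀ h6).1 hgr
    have e : q.2.2 * (6 * B + 1) = 6 * B * q.2.2 + q.2.2 := by ring
    linarith [hg₀.le]
  have hϑ : stepRatio Ω B q.2.2 ≤ Ω * ratioMargin Ω κ R aStar := mul_le_mul_of_nonneg_left hcube hΩ0.le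
  have hqR : ratioMargin Ω κ R aStar ≤ (aStar - R) / (κ * aStar * Ω) := (min_le_left _ _).trans (min_le_right _ _)
  have hϑR : R + κ * aStar * stepRatio Ω B q.2.2 ≤ aStar := by
    have hpos : 0 < κ * aStar * Ω := by positivity
    have h1 : ratioMargin Ω κ R aStar * (κ * aStar * Ω) ≤ aStar - R := (le_div_iff₀ hpos).1 hqR
    have h2 : κ * aStar * stepRatio Ω B q.2.2 ≤ κ * aStar * (Ω * ratioMargin Ω κ R aStar) :=
      mul_le_mul_of_nonneg_left hϑ (by positivity)
    have h3 : κ * aStar * (Ω * ratioMargin Ω κ R aStar) = ratioMargin Ω κ R aStar * (κ * aStar * Ω) := by ring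
    linarith
  have hχ : ∀ j, 0 ≤ cutoffWeight Ω k j := fun j => (h.weight_pos j).le
  have hgb : ∀ j, 0 ≤ (Pf q.1).flow q.2.2 j 0 := fun j => by rw [QuadFlowParams.flow_apply_zero]; exact (h.gbar_pos j).le
  have hh0 : 0 ≤ hh := le_trans zero_le_one ((one_le_hThreshold Ω c C lam M a aStar κ b).trans hc.hh_ge)
  have hratio : ∀ j, cutoffWeight Ω k j * (Pf q.1).flow q.2.2 j 0 ^ 3 ≤
      stepRatio Ω B q.2.2 * (cutoffWeight Ω k (j + 1) * (Pf q.1).flow q.2.2 (j + 1) 0 ^ 3) := fun j => by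
    simpa [QuadFlowParams.flow_apply_zero, stepRatio] using h.toCutoffGbarHyp.weight_cube_le_mul_succ j
  have hK₀' : ‖q.2.1‖ ≤ aStar * cutoffWeight Ω k 0 * (Pf q.1).flow q.2.2 0 0 ^ 3 := by
    rw [cutoffWeight_eq_one_of_le (by simp), QuadFlowParams.flow_apply_zero, gbar_zero]; simpa using hK₀
  have hA3' : HypA3 (cutoffWeight Ω k) (ψf q.1) (ρf q.1) ((Pf q.1).flow q.2.2) a hh κ Ω R M := hA3
  exact hA3'.norm_Kbar_le hχ hgb hh0 ha0.le hc.aStar_lt.le hratio hϑR hK₀' j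

omit [∀ j, CompleteSpace (W j)] in
/-- At an admissible point, a point obeying the `j`-th bounds lies in `D_j`. [cite: BauerschmidtBrydgesSlade2015Flow, §3.2] -/
theorem mem_flowDomain_of_boundAtK (hc : ConstHyp Ω c lam C a κ R M aStar b hh)
    (hA : ∀ (m : Mext) (g : ℝ), 0 < g → g ≤ gThreshold Ω B c C lam M a aStar κ R b hh →
      CutoffQuadHyp (Pf m) Ω k B c ⌊c⁻¹⌋₊ C lam g) {q : Mext × (W 0 × ℝ)}
    (hq : AdmK Pf ψf ρf Ω B c lam C a κ R M aStar b hh k q) {j : ℕ} {xj : W j × V3}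
    (hb : BoundAtK ψf Pf Ω k a aStar hh b q j xj) :
    xj ∈ flowDomain (cutoffWeight Ω k) ((Pf q.1).flow q.2.2) a hh j := by
  have h := hA q.1 q.2.2 hq.1 hq.2.1
  have hh0 : 0 ≤ hh := le_trans zero_le_one ((one_le_hThreshold Ω c C lam M a aStar κ b).trans hc.hh_ge)
  obtain ⟨b1, b2, b3, b4⟩ := hb
  exact mem_flowDomain_of_bounds (h.weight_pos j).le (by rw [QuadFlowParams.flow_apply_zero]; exact (h.gbar_pos j).le)
    hh0 hc.b_lt.le (by linarith [hc.aStar_lt]) (norm_Kb_le_cutoff ψf ρf hc hA hq j) b1 b2 b3 b4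

omit [∀ j, CompleteSpace (W j)] in
/-- `x̄_j = (K̄_j, V̄_j)` obeys the bounds trivially. [cite: BauerschmidtBrydgesSlade2015Flow, §3.2] -/
theorem boundAtK_base (hc : ConstHyp Ω c lam C a κ R M aStar b hh)
    (hA : ∀ (m : Mext) (g : ℝ), 0 < g → g ≤ gThreshold Ω B c C lam M a aStar κ R b hh →
      CutoffQuadHyp (Pf m) Ω k B c ⌊c⁻¹⌋₊ C lam g) {q : Mext × (W 0 × ℝ)}
    (hq : AdmK Pf ψf ρf Ω B c lam C a κ R M aStar b hh k q) (j : ℕ) :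
    BoundAtK ψf Pf Ω k a aStar hh b q j (Kb ψf Pf q j, (Pf q.1).flow q.2.2 j) := by
  have h := hA q.1 q.2.2 hq.1 hq.2.1
  have hh0 : 0 ≤ hh := le_trans zero_le_one ((one_le_hThreshold Ω c C lam M a aStar κ b).trans hc.hh_ge)
  have hw := (h.weight_pos j).le
  have hg : 0 ≤ (Pf q.1).flow q.2.2 j 0 := by rw [QuadFlowParams.flow_apply_zero]; exact (h.gbar_pos j).le
  have hb := hc.b_pos.le; have haS : 0 ≤ a - aStar := by linarith [hc.aStar_lt]
  refine ⟨?_, ?_, ?_, ?_⟩ <;> simp only [sub_self, norm_zero, abs_zero]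
  · positivity
  · positivity
  · positivity
  · positivity

/-- A uniform bound for the initial `𝒱`-component of the critical flow over admissible points (used for
compactness in `ℝ³`): `|g₀| ≤ 1`, `|z₀| ≤ Z + 𝗁`, `|μ₀| ≤ M_μ + 𝗁`.
[cite: BauerschmidtBrydgesSlade2015Flow, Corollary 1.8 (proof: "V₀(m',u₀') is uniformly bounded")] -/
theorem norm_critFlowK_zero_le (hc : ConstHyp Ω c lam C a κ R M aStar b hh)
    (hA : ∀ (m : Mext) (g : ℝ), 0 < g → g ≤ gThreshold Ω B c C lam M a aStar κ R b hh →
      CutoffQuadHyp (Pf m) Ω k B c ⌊c⁻¹⌋₊ C lam g) {q : Mext × (W 0 × ℝ)}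
    (hq : AdmK Pf ψf ρf Ω B c lam C a κ R M aStar b hh k q) :
    ‖(critFlowK ψf ρf hc hA q 0).2‖ ≤
      1 + (2 * C * ((1 + ⌊c⁻¹⌋₊) / c + ⌊c⁻¹⌋₊ + 2 * Ω / (Ω - 1)) + hh) +
        (4 * (C * (3 + 3 * (2 * C * ((1 + ⌊c⁻¹⌋₊) / c + ⌊c⁻¹⌋₊ + 2 * Ω / (Ω - 1))) +
          (2 * C * ((1 + ⌊c⁻¹⌋₊) / c + ⌊c⁻¹⌋₊ + 2 * Ω / (Ω - 1))) ^ 2) / 2) / (lam - 1) + hh) := by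
  obtain ⟨-, -, -, hg0, -, -, hbd, -⟩ := critFlowK_spec ψf ρf hc hA hq
  have h := hA q.1 q.2.2 hq.1 hq.2.1
  have hh0 : 0 ≤ hh := le_trans zero_le_one ((one_le_hThreshold Ω c C lam M a aStar κ b).trans hc.hh_ge)
  obtain ⟨-, b2, b3, b4⟩ := hbd 0
  simp only [QuadFlowParams.flow_apply_zero, QuadFlowParams.flow_apply_one, QuadFlowParams.flow_apply_two,
    gbar_zero] at b2 b3 b4
  have hZ := h.abs_zbar_le' 0
  obtain ⟨hM0, hMu⟩ := h.abs_mubar_le_Mmu 0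
  simp only [gbar_zero] at hZ hMu
  have hgL : q.2.2 * |Real.log q.2.2| ≤ 1 := by simpa using h.gbar_mul_abs_log_le_one 0
  have hχ1 : cutoffWeight Ω k 0 ≤ 1 := h.weight_le_one 0
  have hχ0 : 0 ≤ cutoffWeight Ω k 0 := (h.weight_pos 0).le
  have hg1 : q.2.2 ≤ 1 := by linarith [h.gbar_le_half 0, gbar_zero (Pf q.1).β q.2.2]
  have hb1 := hc.b_lt.le; have hb0 := hc.b_pos.le
  have hZ0 := h.Z_nonneg
  have hlog : 0 ≤ |Real.log q.2.2| := abs_nonneg _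
  -- the three coordinates
  have e0 : |(critFlowK ψf ρf hc hA q 0).2 0| ≤ 1 := by rw [hg0, abs_of_pos hq.1]; exact hg1
  have hq2 : q.2.2 ^ 2 * |Real.log q.2.2| ≤ 1 := by
    calc q.2.2 ^ 2 * |Real.log q.2.2| = q.2.2 * (q.2.2 * |Real.log q.2.2|) := by ring
      _ ≤ 1 * 1 := mul_le_mul hg1 hgL (by have := hq.1.le; positivity) zero_le_one
      _ = 1 := one_mul 1
  have e1 : |(critFlowK ψf ρf hc hA q 0).2 1| ≤ 2 * C * ((1 + ⌊c⁻¹⌋₊) / c + ⌊c⁻¹⌋₊ + 2 * Ω / (Ω - 1)) + hh := by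
    have t : |(critFlowK ψf ρf hc hA q 0).2 1 - (Pf q.1).zbar q.2.2 0| ≤ hh := by
      calc _ ≤ b * hh * cutoffWeight Ω k 0 * q.2.2 ^ 2 * |Real.log q.2.2| := b3
        _ = (b * cutoffWeight Ω k 0) * (q.2.2 ^ 2 * |Real.log q.2.2|) * hh := by ring
        _ ≤ (1 * 1) * 1 * hh := by gcongr
        _ = hh := by ring
    have hz : |(Pf q.1).zbar q.2.2 0| ≤ 2 * C * ((1 + ⌊c⁻¹⌋₊) / c + ⌊c⁻¹⌋₊ + 2 * Ω / (Ω - 1)) :=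
      hZ.trans (mul_le_of_le_one_right hZ0 hg1)
    calc |(critFlowK ψf ρf hc hA q 0).2 1|
        = |(Pf q.1).zbar q.2.2 0 + ((critFlowK ψf ρf hc hA q 0).2 1 - (Pf q.1).zbar q.2.2 0)| := by rw [add_sub_cancel]
      _ ≤ |(Pf q.1).zbar q.2.2 0| + |(critFlowK ψf ρf hc hA q 0).2 1 - (Pf q.1).zbar q.2.2 0| := abs_add_le _ _
      _ ≤ _ := add_le_add hz t
  have e2 : |(critFlowK ψf ρf hc hA q 0).2 2| ≤
      4 * (C * (3 + 3 * (2 * C * ((1 + ⌊c⁻¹⌋₊) / c + ⌊c⁻¹⌋₊ + 2 * Ω / (Ω - 1))) +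
        (2 * C * ((1 + ⌊c⁻¹⌋₊) / c + ⌊c⁻¹⌋₊ + 2 * Ω / (Ω - 1))) ^ 2) / 2) / (lam - 1) + hh := by
    have t : |(critFlowK ψf ρf hc hA q 0).2 2 - (Pf q.1).mubar q.2.2 0| ≤ hh := by
      calc _ ≤ b * hh * cutoffWeight Ω k 0 * q.2.2 ^ 2 * |Real.log q.2.2| := b4
        _ = (b * cutoffWeight Ω k 0) * (q.2.2 ^ 2 * |Real.log q.2.2|) * hh := by ring
        _ ≤ (1 * 1) * 1 * hh := by gcongr
        _ = hh := by ring
    have hm := hMu.trans (mul_le_of_le_one_right hM0 hg1)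
    calc |(critFlowK ψf ρf hc hA q 0).2 2|
        = |(Pf q.1).mubar q.2.2 0 + ((critFlowK ψf ρf hc hA q 0).2 2 - (Pf q.1).mubar q.2.2 0)| := by rw [add_sub_cancel]
      _ ≤ |(Pf q.1).mubar q.2.2 0| + |(critFlowK ψf ρf hc hA q 0).2 2 - (Pf q.1).mubar q.2.2 0| := abs_add_le _ _
      _ ≤ _ := add_le_add hm t
  have hpos1 : 0 ≤ 2 * C * ((1 + ⌊c⁻¹⌋₊) / c + ⌊c⁻¹⌋₊ + 2 * Ω / (Ω - 1)) + hh := by linarith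
  have hpos2 : 0 ≤ 4 * (C * (3 + 3 * (2 * C * ((1 + ⌊c⁻¹⌋₊) / c + ⌊c⁻¹⌋₊ + 2 * Ω / (Ω - 1))) +
      (2 * C * ((1 + ⌊c⁻¹⌋₊) / c + ⌊c⁻¹⌋₊ + 2 * Ω / (Ω - 1))) ^ 2) / 2) / (lam - 1) + hh := by linarith
  refine norm_V3_le (by linarith) ?_ ?_ ?_
  · linarith
  · linarith
  · linarith

end Corollary18b

section Corollary18c

variable {Mext : Type*} [TopologicalSpace Mext]
variable {W : ℕ → Type*} [∀ j, NormedAddCommGroup (W j)] [∀ j, NormedSpace ℝ (W j)] [∀ j, CompleteSpace (W j)]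
variable {Pf : Mext → QuadFlowParams} (ψf : ∀ m : Mext, ∀ j, W j × V3 → W (j + 1)) (ρf : ∀ m : Mext, ∀ j, W j × V3 → V3)
  {Ω B c lam C a κ R M aStar b hh : ℝ} {k : ℕ∞}

omit [TopologicalSpace Mext] in
/-- `‖V₀(q)‖ ≤ R_V` at admissible `q`. [cite: BauerschmidtBrydgesSlade2015Flow, Corollary 1.8 (proof)] -/
theorem norm_critFlowK_zero_le' (hc : ConstHyp Ω c lam C a κ R M aStar b hh)
    (hA : ∀ (m : Mext) (g : ℝ), 0 < g → g ≤ gThreshold Ω B c C lam M a aStar κ R b hh →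
      CutoffQuadHyp (Pf m) Ω k B c ⌊c⁻¹⌋₊ C lam g) {q : Mext × (W 0 × ℝ)}
    (hq : AdmK Pf ψf ρf Ω B c lam C a κ R M aStar b hh k q) :
    ‖(critFlowK ψf ρf hc hA q 0).2‖ ≤ V0Bound Ω c C lam hh :=
  norm_critFlowK_zero_le ψf ρf hc hA hq

omit [∀ j, CompleteSpace (W j)] in
/-- Along a filter of admissible points converging to an admissible `q₀`, `V̄_j(q) → V̄_j(q₀)`.
[cite: BauerschmidtBrydgesSlade2015Flow, Proposition 1.2 (continuity) as used in Corollary 1.8] -/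
theorem tendsto_flow_of_le_nhdsK (hc : ConstHyp Ω c lam C a κ R M aStar b hh)
    (hA12 : ∀ m, HypA1 (Pf m).β Ω B c ∧ HypA2 (Pf m) Ω lam c C) (hP : CoeffContinuous Pf)
    {q₀ : Mext × (W 0 × ℝ)} (hq₀ : AdmK Pf ψf ρf Ω B c lam C a κ R M aStar b hh k q₀) {F : Filter (Mext × (W 0 × ℝ))}
    (hF : F ≤ 𝓝 q₀) (hadm : ∀ᶠ q in F, AdmK Pf ψf ρf Ω B c lam C a κ R M aStar b hh k q) (j : ℕ) :
    Tendsto (fun q => (Pf q.1).flow q.2.2 j) F (𝓝 ((Pf q₀.1).flow q₀.2.2 j)) := by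
  have hgt : gThreshold Ω B c C lam M a aStar κ R b hh ≤ quadThreshold Ω B c C lam :=
    (min_le_left _ _).trans ((min_le_left _ _).trans (min_le_left _ _))
  have hmem : (q₀.1, q₀.2.2) ∈ admSet Mext (quadThreshold Ω B c C lam) := ⟨hq₀.1, hq₀.2.1.trans hgt⟩
  have hcont := (continuousOn_flow_param (Mext := Mext) hc.one_lt_Ω hA12 hP j) (q₀.1, q₀.2.2) hmem
  have h2 : Tendsto (fun q : Mext × (W 0 × ℝ) => (q.1, q.2.2)) F (𝓝[admSet Mext (quadThreshold Ω B c C lam)] (q₀.1, q₀.2.2)) := by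
    refine tendsto_nhdsWithin_iff.2 ⟨?_, hadm.mono fun q hq => ⟨hq.1, hq.2.1.trans hgt⟩⟩
    exact ((continuous_fst.prodMk (continuous_snd.comp continuous_snd)).tendsto q₀).mono_left hF
  exact hcont.tendsto.comp h2

omit [∀ j, CompleteSpace (W j)] in
/-- **Passing to the limit in the bounds (1.11)–(1.14)** along a filter of admissible points ("we can now take
the limit of (1.11′)–(1.14′)"), using `χ_j(m') → χ_j(m)` and the continuity of `V̄_j`.
[cite: BauerschmidtBrydgesSlade2015Flow, Corollary 1.8 (proof)] -/
theorem boundAtK_of_tendsto (hc : ConstHyp Ω c lam C a κ R M aStar b hh)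
    (hA : ∀ (m : Mext) (g : ℝ), 0 < g → g ≤ gThreshold Ω B c C lam M a aStar κ R b hh →
      CutoffQuadHyp (Pf m) Ω k B c ⌊c⁻¹⌋₊ C lam g)
    (hA12 : ∀ m, HypA1 (Pf m).β Ω B c ∧ HypA2 (Pf m) Ω lam c C) (hP : CoeffContinuous Pf)
    {q₀ : Mext × (W 0 × ℝ)} (hq₀ : AdmK Pf ψf ρf Ω B c lam C a κ R M aStar b hh k q₀) {j : ℕ}
    {F : Filter (Mext × (W 0 × ℝ))} [F.NeBot]
    (hF : F ≤ 𝓝 q₀) (hadm : ∀ᶠ q in F, AdmK Pf ψf ρf Ω B c lam C a κ R M aStar b hh k q)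
    {y : Mext × (W 0 × ℝ) → W j × V3} {ys : W j × V3} (hy : Tendsto y F (𝓝 ys))
    (hK : Tendsto (fun q => Kb ψf Pf q j) F (𝓝 (Kb ψf Pf q₀ j)))
    (hb : ∀ᶠ q in F, BoundAtK ψf Pf Ω k a aStar hh b q j (y q)) :
    BoundAtK ψf Pf Ω k a aStar hh b q₀ j ys := by
  have hV := tendsto_flow_of_le_nhdsK ψf ρf hc hA12 hP hq₀ hF hadm j
  have hVi : ∀ i : Fin 3, Tendsto (fun q => (Pf q.1).flow q.2.2 j i) F (𝓝 ((Pf q₀.1).flow q₀.2.2 j i)) := fun i =>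
    ((continuous_apply i).tendsto _).comp hV
  have hV0 := hVi 0
  have h0 := hA q₀.1 q₀.2.2 hq₀.1 hq₀.2.1
  have hgpos : (Pf q₀.1).flow q₀.2.2 j 0 ≠ 0 := by rw [QuadFlowParams.flow_apply_zero]; exact (h0.gbar_pos j).ne'
  have hlog : Tendsto (fun q => |Real.log ((Pf q.1).flow q.2.2 j 0)|) F (𝓝 |Real.log ((Pf q₀.1).flow q₀.2.2 j 0)|) :=
    ((Real.continuousAt_log hgpos).tendsto.comp hV0).abs
  have hχ' : Tendsto (fun _ : Mext × (W 0 × ℝ) => cutoffWeight Ω k j) F (𝓝 (cutoffWeight Ω k j)) :=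
    tendsto_const_nhds
  have hy1 : Tendsto (fun q => (y q).1) F (𝓝 ys.1) := (continuous_fst.tendsto ys).comp hy
  have hy2 : ∀ i : Fin 3, Tendsto (fun q => (y q).2 i) F (𝓝 (ys.2 i)) := fun i =>
    ((continuous_apply i).tendsto _).comp ((continuous_snd.tendsto ys).comp hy)
  refine ⟨?_, ?_, ?_, ?_⟩
  · exact le_of_tendsto_of_tendsto (hy1.sub hK).norm ((tendsto_const_nhds.mul hχ').mul (hV0.pow 3))
      (hb.mono fun q h => h.1)
  · exact le_of_tendsto_of_tendsto ((hy2 0).sub hV0).abs ((tendsto_const_nhds.mul (hV0.pow 2)).mul hlog)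
      (hb.mono fun q h => h.2.1)
  · exact le_of_tendsto_of_tendsto ((hy2 1).sub (hVi 1)).abs (((tendsto_const_nhds.mul hχ').mul (hV0.pow 2)).mul hlog)
      (hb.mono fun q h => h.2.2.1)
  · exact le_of_tendsto_of_tendsto ((hy2 2).sub (hVi 2)).abs (((tendsto_const_nhds.mul hχ').mul (hV0.pow 2)).mul hlog)
      (hb.mono fun q h => h.2.2.2)

/-- **The orbit argument of Corollary 1.8**: along any non-trivial filter of admissible points converging to
`q₀` along which `V₀` converges to some `V₀^*`, the whole critical flow converges to the critical flow at
`q₀` (the `Φ(m)`-orbit `x^*` of `(K₀, V₀^*)` is a flow with the boundary conditions and the bounds, hence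
equals `x(m, u₀)` by uniqueness). [cite: BauerschmidtBrydgesSlade2015Flow, Corollary 1.8 (proof)] -/
theorem critFlowK_tendsto_of_tendsto_zero (hc : ConstHyp Ω c lam C a κ R M aStar b hh)
    (hA : ∀ (m : Mext) (g : ℝ), 0 < g → g ≤ gThreshold Ω B c C lam M a aStar κ R b hh →
      CutoffQuadHyp (Pf m) Ω k B c ⌊c⁻¹⌋₊ C lam g)
    (hA12 : ∀ m, HypA1 (Pf m).β Ω B c ∧ HypA2 (Pf m) Ω lam c C) (hP : CoeffContinuous Pf)
    (hψ : ∀ (j : ℕ) (m : Mext) (g : ℝ) (x : W j × V3), x ∈ flowDomain (cutoffWeight Ω k) ((Pf m).flow g) a hh j →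
      ContinuousAt (fun p : Mext × (W j × V3) => ψf p.1 j p.2) (m, x))
    (hρ : ∀ (j : ℕ) (m : Mext) (g : ℝ) (x : W j × V3), x ∈ flowDomain (cutoffWeight Ω k) ((Pf m).flow g) a hh j →
      ContinuousAt (fun p : Mext × (W j × V3) => ρf p.1 j p.2) (m, x))
    {q₀ : Mext × (W 0 × ℝ)} (hq₀ : AdmK Pf ψf ρf Ω B c lam C a κ R M aStar b hh k q₀)
    {F : Filter (Mext × (W 0 × ℝ))} [F.NeBot] (hF : F ≤ 𝓝[{q | AdmK Pf ψf ρf Ω B c lam C a κ R M aStar b hh k q}] q₀)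
    {Vs : V3} (hV : Tendsto (fun q => (critFlowK ψf ρf hc hA q 0).2) F (𝓝 Vs)) (j : ℕ) :
    Tendsto (fun q => critFlowK ψf ρf hc hA q j) F (𝓝 (critFlowK ψf ρf hc hA q₀ j)) := by
  have hadm : ∀ᶠ q in F, AdmK Pf ψf ρf Ω B c lam C a κ R M aStar b hh k q := hF self_mem_nhdsWithin
  have hF' : F ≤ 𝓝 q₀ := hF.trans nhdsWithin_le_nhds
  have hq1 : Tendsto (fun q : Mext × (W 0 × ℝ) => q.1) F (𝓝 q₀.1) := (continuous_fst.tendsto q₀).mono_left hF'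
  have hK0 : Tendsto (fun q : Mext × (W 0 × ℝ) => q.2.1) F (𝓝 q₀.2.1) :=
    ((continuous_fst.comp continuous_snd).tendsto q₀).mono_left hF'
  have hg : Tendsto (fun q : Mext × (W 0 × ℝ) => q.2.2) F (𝓝 q₀.2.2) :=
    ((continuous_snd.comp continuous_snd).tendsto q₀).mono_left hF'
  -- `V₀^*` has `g`-coordinate `g₀`
  have hVs0 : Vs 0 = q₀.2.2 := by
    have t1 : Tendsto (fun q => (critFlowK ψf ρf hc hA q 0).2 0) F (𝓝 (Vs 0)) := ((continuous_apply 0).tendsto _).comp hV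
    have t2 : Tendsto (fun q => (critFlowK ψf ρf hc hA q 0).2 0) F (𝓝 q₀.2.2) :=
      hg.congr' (hadm.mono fun q hq => ((critFlowK_spec ψf ρf hc hA hq).2.2.2.1).symm)
    exact tendsto_nhds_unique t1 t2
  -- the orbit `x^*` of `(K₀, V₀^*)` under `Φ(m)`
  let xs : ∀ j, W j × V3 := fun j => @Nat.rec (fun j => W j × V3) (q₀.2.1, Vs)
    (fun j xj => (ψf q₀.1 j xj, (Pf q₀.1).map j xj.2 + ρf q₀.1 j xj)) j
  have xs0 : xs 0 = (q₀.2.1, Vs) := rfl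
  have xsS : ∀ j, xs (j + 1) = (ψf q₀.1 j (xs j), (Pf q₀.1).map j (xs j).2 + ρf q₀.1 j (xs j)) := fun j => rfl
  -- the induction: `K̄_j(q) → K̄_j(q₀)`, `x_j(q) → x^*_j`, and `x^*_j` obeys the `j`-th bounds at `q₀`
  have ind : ∀ j, Tendsto (fun q => Kb ψf Pf q j) F (𝓝 (Kb ψf Pf q₀ j)) ∧
      Tendsto (fun q => critFlowK ψf ρf hc hA q j) F (𝓝 (xs j)) ∧ BoundAtK ψf Pf Ω k a aStar hh b q₀ j (xs j) := by
    intro j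
    induction j with
    | zero =>
      have hK : Tendsto (fun q => Kb ψf Pf q 0) F (𝓝 (Kb ψf Pf q₀ 0)) := hK0
      have hc0 : Tendsto (fun q => critFlowK ψf ρf hc hA q 0) F (𝓝 (xs 0)) := by
        have t1 : Tendsto (fun q => (critFlowK ψf ρf hc hA q 0).1) F (𝓝 q₀.2.1) :=
          hK0.congr' (hadm.mono fun q hq => ((critFlowK_spec ψf ρf hc hA hq).2.2.1).symm)
        simpa only [xs0, Prod.mk.eta] using t1.prodMk_nhds hV
      refine ⟨hK, hc0, ?_⟩
      exact boundAtK_of_tendsto ψf ρf hc hA hA12 hP hq₀ hF' hadm hc0 hK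
        (hadm.mono fun q hq => ((flowBounds_iff_boundAtK ψf q _).1 (critFlowK_spec ψf ρf hc hA hq).2.2.2.2.2.2.1) 0)
    | succ j ih =>
      obtain ⟨hKj, hcj, hbj⟩ := ih
      have hVj := tendsto_flow_of_le_nhdsK ψf ρf hc hA12 hP hq₀ hF' hadm j
      have hdom : xs j ∈ flowDomain (cutoffWeight Ω k) ((Pf q₀.1).flow q₀.2.2) a hh j :=
        mem_flowDomain_of_boundAtK ψf ρf hc hA hq₀ hbj
      have hdom0 : (Kb ψf Pf q₀ j, (Pf q₀.1).flow q₀.2.2 j) ∈ flowDomain (cutoffWeight Ω k) ((Pf q₀.1).flow q₀.2.2) a hh j :=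
        mem_flowDomain_of_boundAtK ψf ρf hc hA hq₀ (boundAtK_base ψf ρf hc hA hq₀ j)
      -- `K̄_{j+1}(q) = ψ_j(m')(K̄_j(q), V̄_j(q)) → ψ_j(m)(K̄_j(q₀), V̄_j(q₀))`
      have hK : Tendsto (fun q => Kb ψf Pf q (j + 1)) F (𝓝 (Kb ψf Pf q₀ (j + 1))) := by
        have := (hψ j q₀.1 q₀.2.2 _ hdom0).tendsto.comp (hq1.prodMk_nhds (hKj.prodMk_nhds hVj))
        exact this
      -- `x_{j+1}(q) = Φ_j(m')(x_j(q)) → Φ_j(m)(x^*_j) = x^*_{j+1}`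
      have hcS : Tendsto (fun q => critFlowK ψf ρf hc hA q (j + 1)) F (𝓝 (xs (j + 1))) := by
        have tψ : Tendsto (fun q => ψf q.1 j (critFlowK ψf ρf hc hA q j)) F (𝓝 (ψf q₀.1 j (xs j))) :=
          (hψ j q₀.1 q₀.2.2 _ hdom).tendsto.comp (hq1.prodMk_nhds hcj)
        have tρ : Tendsto (fun q => ρf q.1 j (critFlowK ψf ρf hc hA q j)) F (𝓝 (ρf q₀.1 j (xs j))) :=
          (hρ j q₀.1 q₀.2.2 _ hdom).tendsto.comp (hq1.prodMk_nhds hcj)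
        have tm : Tendsto (fun q => (Pf q.1).map j (critFlowK ψf ρf hc hA q j).2) F (𝓝 ((Pf q₀.1).map j (xs j).2)) :=
          ((continuous_map_param hP j).tendsto _).comp (hq1.prodMk_nhds ((continuous_snd.tendsto _).comp hcj))
        have tall := tψ.prodMk_nhds (tm.add tρ)
        rw [xsS]
        refine tall.congr' (hadm.mono fun q hq => ?_)
        exact ((critFlowK_spec ψf ρf hc hA hq).2.1 j).symm
      refine ⟨hK, hcS, ?_⟩
      exact boundAtK_of_tendsto ψf ρf hc hA hA12 hP hq₀ hF' hadm hcS hK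
        (hadm.mono fun q hq => ((flowBounds_iff_boundAtK ψf q _).1 (critFlowK_spec ψf ρf hc hA hq).2.2.2.2.2.2.1) (j + 1))
  -- `x^*` is a flow at `q₀` with the boundary conditions and the bounds
  have hflow : IsPerturbedFlow (Pf q₀.1) (ψf q₀.1) (ρf q₀.1) xs := fun j => rfl
  have hx0 : (xs 0).1 = q₀.2.1 := rfl
  have hxg : (xs 0).2 0 = q₀.2.2 := hVs0
  have hbds : FlowBounds (cutoffWeight Ω k) (ψf q₀.1) ((Pf q₀.1).flow q₀.2.2) q₀.2.1 a aStar hh b xs :=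
    (flowBounds_iff_boundAtK ψf q₀ xs).2 fun j => (ind j).2.2
  have h0 := hA q₀.1 q₀.2.2 hq₀.1 hq₀.2.1
  have hh0 : 0 ≤ hh := le_trans zero_le_one ((one_le_hThreshold Ω c C lam M a aStar κ b).trans hc.hh_ge)
  have hsmallseq : Tendsto (fun j => b * hh * (cutoffWeight Ω k j * gbar (Pf q₀.1).β q₀.2.2 j)) atTop (𝓝 0) := by
    have := h0.tendsto_weight_mul_gbar_zero.const_mul (b * hh)
    rw [mul_zero] at this
    exact this
  have hdev : ∀ j (i : Fin 3), i ≠ 0 →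
      |(xs j).2 i - (Pf q₀.1).flow q₀.2.2 j i| ≤ b * hh * (cutoffWeight Ω k j * gbar (Pf q₀.1).β q₀.2.2 j) := by
    intro j i hi
    obtain ⟨-, -, b3, b4⟩ := (ind j).2.2
    have hgL := h0.gbar_mul_abs_log_le_one j
    have hw := (h0.weight_pos j).le; have hgp := (h0.gbar_pos j).le; have hb := hc.b_pos.le
    have key : b * hh * cutoffWeight Ω k j * (Pf q₀.1).flow q₀.2.2 j 0 ^ 2 * |Real.log ((Pf q₀.1).flow q₀.2.2 j 0)| ≤
        b * hh * (cutoffWeight Ω k j * gbar (Pf q₀.1).β q₀.2.2 j) := by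
      rw [QuadFlowParams.flow_apply_zero]
      calc b * hh * cutoffWeight Ω k j * gbar (Pf q₀.1).β q₀.2.2 j ^ 2 *
            |Real.log (gbar (Pf q₀.1).β q₀.2.2 j)|
          = b * hh * (cutoffWeight Ω k j * gbar (Pf q₀.1).β q₀.2.2 j) *
              (gbar (Pf q₀.1).β q₀.2.2 j * |Real.log (gbar (Pf q₀.1).β q₀.2.2 j)|) := by ring
        _ ≤ b * hh * (cutoffWeight Ω k j * gbar (Pf q₀.1).β q₀.2.2 j) * 1 := by gcongr
        _ = _ := mul_one _
    fin_cases i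
    · exact absurd rfl hi
    · exact b3.trans key
    · exact b4.trans key
  have tz : Tendsto (fun j => (xs j).2 1) atTop (𝓝 0) := by
    have t1 : Tendsto (fun j => (Pf q₀.1).flow q₀.2.2 j 1) atTop (𝓝 0) := by
      simpa [QuadFlowParams.flow_apply_one] using h0.tendsto_zbar_zero
    have t2 : Tendsto (fun j => (xs j).2 1 - (Pf q₀.1).flow q₀.2.2 j 1) atTop (𝓝 0) :=
      squeeze_zero_norm (fun j => (Real.norm_eq_abs _).trans_le (hdev j 1 (by decide))) hsmallseq
    simpa using t2.add t1
  have tμ : Tendsto (fun j => (xs j).2 2) atTop (𝓝 0) := by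
    have t1 : Tendsto (fun j => (Pf q₀.1).flow q₀.2.2 j 2) atTop (𝓝 0) := by
      simpa [QuadFlowParams.flow_apply_two] using h0.tendsto_mubar_zero
    have t2 : Tendsto (fun j => (xs j).2 2 - (Pf q₀.1).flow q₀.2.2 j 2) atTop (𝓝 0) :=
      squeeze_zero_norm (fun j => (Real.norm_eq_abs _).trans_le (hdev j 2 (by decide))) hsmallseq
    simpa using t2.add t1
  -- uniqueness at `q₀`
  have huniq : xs = critFlowK ψf ρf hc hA q₀ :=
    (critFlowK_spec ψf ρf hc hA hq₀).2.2.2.2.2.2.2 xs hflow hx0 hxg tz tμ hbds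
  rw [← huniq]
  exact (ind j).2.1

/-- **[BBS-rg-flow, Corollary 1.8]**: assume `Φ_j(·, m) = (ψ(m), φ̄(m) + ρ(m))` are continuous in `(m, x)` at
the points of the domains, the coefficients of `φ̄(m)` are continuous in `m`, (A1)–(A3) hold for every `m`
with `m`-independent parameters, and `χ_j(m') → χ_j(m)` (the paper's implicit assumption, made explicit).
Let `x(m, u₀)`, `u₀ = (K₀, g₀)`, be the global flow of Theorem 1.4 (`critFlowK`). Then for each `j`,
`x_j` is continuous in `(m, u₀)` at every admissible point, within the admissible set.
[cite: BauerschmidtBrydgesSlade2015Flow, Corollary 1.8] -/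
theorem critFlowK_continuousWithinAt (hc : ConstHyp Ω c lam C a κ R M aStar b hh)
    (hA : ∀ (m : Mext) (g : ℝ), 0 < g → g ≤ gThreshold Ω B c C lam M a aStar κ R b hh →
      CutoffQuadHyp (Pf m) Ω k B c ⌊c⁻¹⌋₊ C lam g)
    (hA12 : ∀ m, HypA1 (Pf m).β Ω B c ∧ HypA2 (Pf m) Ω lam c C) (hP : CoeffContinuous Pf)
    (hψ : ∀ (j : ℕ) (m : Mext) (g : ℝ) (x : W j × V3), x ∈ flowDomain (cutoffWeight Ω k) ((Pf m).flow g) a hh j →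
      ContinuousAt (fun p : Mext × (W j × V3) => ψf p.1 j p.2) (m, x))
    (hρ : ∀ (j : ℕ) (m : Mext) (g : ℝ) (x : W j × V3), x ∈ flowDomain (cutoffWeight Ω k) ((Pf m).flow g) a hh j →
      ContinuousAt (fun p : Mext × (W j × V3) => ρf p.1 j p.2) (m, x))
    {q₀ : Mext × (W 0 × ℝ)} (hq₀ : AdmK Pf ψf ρf Ω B c lam C a κ R M aStar b hh k q₀)
    (j : ℕ) :
    ContinuousWithinAt (fun q => critFlowK ψf ρf hc hA q j) {q | AdmK Pf ψf ρf Ω B c lam C a κ R M aStar b hh k q} q₀ := by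
  set A := {q : Mext × (W 0 × ℝ) | AdmK Pf ψf ρf Ω B c lam C a κ R M aStar b hh k q} with hAset
  haveI : (𝓝[A] q₀).NeBot := mem_closure_iff_nhdsWithin_neBot.1 (subset_closure hq₀)
  -- continuity of `V₀` by compactness and uniqueness of the cluster point
  have T0 : Tendsto (fun q => (critFlowK ψf ρf hc hA q 0).2) (𝓝[A] q₀) (𝓝 (critFlowK ψf ρf hc hA q₀ 0).2) := by
    refine (isCompact_closedBall (0 : V3) (V0Bound Ω c C lam hh)).tendsto_nhds_of_unique_mapClusterPt ?_ ?_
    · exact (eventually_mem_nhdsWithin).mono fun q hq => mem_closedBall_zero_iff.2 (norm_critFlowK_zero_le' ψf ρf hc hA hq)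
    · intro V _ hcl
      obtain ⟨F, hne, hle, hT⟩ := exists_le_tendsto_of_mapClusterPt hcl
      haveI := hne
      have h1 := critFlowK_tendsto_of_tendsto_zero ψf ρf hc hA hA12 hP hψ hρ hq₀ hle hT 0
      have h2 : Tendsto (fun q => (critFlowK ψf ρf hc hA q 0).2) F (𝓝 (critFlowK ψf ρf hc hA q₀ 0).2) :=
        (continuous_snd.tendsto _).comp h1
      exact tendsto_nhds_unique hT h2
  exact critFlowK_tendsto_of_tendsto_zero ψf ρf hc hA hA12 hP hψ hρ hq₀ le_rfl T0 j

end Corollary18c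

end CTWSAW

end Literature.Barriers.CriticalPhenomena
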